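import Literature.MathematicalPhysics.QuantumFieldTheory.ConformalBootstrap3D.PointKernelLowerM
import Literature.MathematicalPhysics.QuantumFieldTheory.ConformalBootstrap3D.PointFunctionalQuadCell

/-!
# The lower-box kernel certificate theorem with Taylor-model (kernel v3) head cells

`PCert.boxExcluded_of_kernelC_lowerSM` (PointKernelLowerM) takes the `ε`-row and head-row cells as
segment facts of the monotone / interval corner rules ((O2)–(O4) of the typer-g7 kernel).  On the
pub-ising3d lower box `[0.515, 0.520] × [0.6, 0.95)` those rules are too weak (the LP certificate is
boundary-tight; the row `ℓ = 6` dips to `≈ 10⁻⁵`), and the head cells are certified instead by the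
Taylor-model cell kernel `PointKernelTM` / `PointKernelTMCell`, whose per-cell output is a
`BlockPositive` fact conditional on the box's `s`-range and on the tail hypothesis
(`PKTM.blockPositive_of_cellPass`).  This file packages that output as `PCert.V3Block` and gives the
certificate theorem `PCert.boxExcluded_of_kernelV3`: the cheap kernel checks of the lower pipeline
verbatim ((O1) per `s`-piece, (T) with the domination data `tOK`, (M) per `s`-piece from corner box
tables `mMetaOK` / `hboxes`), the row grids `t`, `tε` with their end points, and one `V3Block` per
cell; the conclusion is `BoxExcluded (QBoxL s_lo s_hi ε_lo ε_hi)` via `boxExcluded_of_pointCells`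
(PointFunctionalQuadCell) and `tail_nonneg_of_pointRules_twist`.
[cite: HogervorstRychkov2013, §3 eq. (3.6)]
-/

noncomputable section

namespace Literature.MathematicalPhysics.QuantumFieldTheory.ConformalBootstrap3D

open Real Finset Set

namespace PointKernel

namespace PCert

variable (c : PCert)

/-- **A kernel-v3 cell fact.** Row `ℓ`, cell `[a, b)`: for every box `Q` of `s`-range
`[c.slo, c.shi]` on which the tail terms (`E ≥ E₀`, `j + τ ≤ E`, `j ≤ E`) are non-negative, the point
functional of `c` is block-positive at `(s, Δ, ℓ)` for all `s ∈ Q`, `Δ ∈ [a, b)` — the statement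
proved per cell by `PKTM.blockPositive_of_cellPass`. [folklore] -/
def V3Block (E₀ τ a b : ℝ) (ℓ : ℕ) : Prop :=
  ∀ Q : Set (ℝ × ℝ), (∀ q ∈ Q, ((c.slo : ℚ) : ℝ) ≤ q.1 ∧ q.1 ≤ ((c.shi : ℚ) : ℝ)) →
    (∀ (j : ℕ) (E : ℝ), E₀ ≤ E → (j : ℝ) + τ ≤ E → (j : ℝ) ≤ E → ∀ q ∈ Q,
      0 ≤ pointFunctional c.wR c.zR c.zbR (crossF q.1 (-1) (zMono E j))) →
    ∀ q ∈ Q, ∀ Δ ∈ Ico a b, BlockPositive (pointFunctional c.wR c.zR c.zbR) q.1 Δ ℓ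

variable {c}

/-- a `V3Block` on `[a, b)` restricts to `[a', b')` with `a ≤ a'`, `b' ≤ b` (top-anchored last cells
overlap their predecessor). [folklore] -/
theorem V3Block.mono {E₀ τ a b a' b' : ℝ} {ℓ : ℕ} (h : c.V3Block E₀ τ a b ℓ) (ha : a ≤ a')
    (hb : b' ≤ b) : c.V3Block E₀ τ a' b' ℓ :=
  fun Q hQ htail q hq Δ hΔ => h Q hQ htail q hq Δ ⟨ha.trans hΔ.1, lt_of_lt_of_le hΔ.2 hb⟩

/-- **The lower-box certificate theorem of the kernel, v3 head cells.** Hypotheses: the node checks;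
(O1) on the pieces of an `s`-partition; the domination data and (T) (`tOK`); the parameters
(`τ ≤ 1`, `τ ≤ E₀`, `E₀ ≤ L + 1`, `E_T ≤ J + τ`); (M) per `s`-piece from corner box tables; the
`ε`-row grid `tε_0 = ε_lo, …, tε_{Kε} = ε_hi` and the head-row grids `t ℓ 0, …, t ℓ (K ℓ) = E₀`
(`t 0 0 ≤ 3`, `t ℓ 0 = ℓ + 1` for even `0 < ℓ < L`); one `V3Block` per cell.  Conclusion: the box
`[s_lo, s_hi] × [ε_lo, ε_hi)` is excluded. [cite: HogervorstRychkov2013, §3 eq. (3.6)] -/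
theorem boxExcluded_of_kernelV3 (hc : c.checkNodes = true)
    (KI : ℕ) (σI : ℕ → ℚ) (hKI : 0 < KI) (hσI0 : σI 0 = c.slo) (hσIK : σI KI = c.shi)
    (hIrow : ∀ i < KI, ∀ s ∈ Icc ((σI i : ℚ) : ℝ) ((σI (i + 1) : ℚ) : ℝ),
      0 < pointFunctional c.wR c.zR c.zbR (crossF s (-1) (fun _ _ => (1 : ℝ))))
    (qd qr : List ℚ) (ET : ℕ) (hT : c.tOK qd qr ET = true)
    (εlo εhi E0 τ : ℚ) (L J : ℕ) (hτ1 : τ ≤ 1) (hτ0 : τ ≤ E0) (hL : E0 ≤ (L : ℚ) + 1)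
    (hJ : (ET : ℚ) ≤ (J : ℚ) + τ)
    (KM : ℕ) (σM : ℕ → ℚ) (hKM : 0 < KM) (hσM0 : σM 0 = c.slo) (hσMK : σM KM = c.shi)
    (mrowsP : ℕ → List MRow) (hmetaM : ∀ i < KM, c.mMetaOK (mrowsP i) E0 τ ET J = true)
    (hboxes : ∀ i < KM, ∀ j < J, ∀ m < (rowAt (mrowsP i) j).steps.length,
      0 ≤ termCornerBound c.wR c.zR c.zbR j (c.eM (mrowsP i) j m) (c.eM (mrowsP i) j (m + 1))
        ((σM i : ℚ) : ℝ) ((σM (i + 1) : ℚ) : ℝ))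
    (t : ℕ → ℕ → ℝ) (K : ℕ → ℕ) (tε : ℕ → ℝ) (Kε : ℕ)
    (htε : tε 0 = ((εlo : ℚ) : ℝ) ∧ tε Kε = ((εhi : ℚ) : ℝ))
    (ht0 : t 0 0 ≤ 3 ∧ t 0 (K 0) = ((E0 : ℚ) : ℝ))
    (htℓ : ∀ ℓ, Even ℓ → ℓ ≠ 0 → ℓ < L → t ℓ 0 = (ℓ : ℝ) + 1 ∧ t ℓ (K ℓ) = ((E0 : ℚ) : ℝ))
    (hcellε : ∀ k < Kε, c.V3Block ((E0 : ℚ) : ℝ) ((τ : ℚ) : ℝ) (tε k) (tε (k + 1)) 0)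
    (hcell : ∀ ℓ, (ℓ = 0 ∨ (Even ℓ ∧ ℓ < L)) → ∀ k < K ℓ,
      c.V3Block ((E0 : ℚ) : ℝ) ((τ : ℚ) : ℝ) (t ℓ k) (t ℓ (k + 1)) ℓ) :
    BoxExcluded (QBoxL c.slo c.shi εlo εhi) := by
  obtain ⟨hqd, hqr, hdomd, hdomr, hB⟩ := t_hyps hc qd qr ET hT
  have hz := zR_mem hc
  have hzb := zbR_mem hc
  have hord : ∀ k : Fin c.N, c.zbR k ≤ c.zR k := by
    intro k
    have hn := checkNode_of_checkNodes hc k.2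
    simpa [zR, zbR] using (show ((c.zb k : ℚ) : ℝ) ≤ ((c.z k : ℚ) : ℝ) by exact_mod_cast zb_le_z hn)
  have hapex : 0 ≤ c.wR ⟨c.apex, apex_lt hc⟩ := by
    simpa [wR] using (show ((0 : ℚ) : ℝ) ≤ ((c.w c.apex : ℚ) : ℝ) by exact_mod_cast w_apex_nonneg hc)
  have hQ1 : ∀ p ∈ QBoxL c.slo c.shi εlo εhi, ((c.slo : ℚ) : ℝ) ≤ p.1 ∧ p.1 ≤ ((c.shi : ℚ) : ℝ) :=
    fun p hp => hp.1
  -- (O1) from the identity pieces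
  have hI : ∀ p ∈ QBoxL c.slo c.shi εlo εhi,
      0 < pointFunctional c.wR c.zR c.zbR (crossF p.1 (-1) (fun _ _ => (1 : ℝ))) := by
    intro p hp
    obtain ⟨i, hi, hs⟩ := exists_piece_Icc (fun i => ((σI i : ℚ) : ℝ)) KI hKI p.1
      ⟨by simp only [hσI0]; exact hp.1.1, by simp only [hσIK]; exact hp.1.2⟩
    exact hIrow i hi p.1 hs
  have hJR : ((ET : ℕ) : ℝ) ≤ (J : ℝ) + ((τ : ℚ) : ℝ) := by
    have : (((ET : ℚ)) : ℝ) ≤ (((J : ℚ) + τ : ℚ) : ℝ) := by exact_mod_cast hJ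
    push_cast at this; exact this
  -- (M) from the (M) pieces
  have hM := ruleM_of_cornerTables_pieces c.wR c.zR c.zbR hz hzb
    (Q := QBoxL c.slo c.shi εlo εhi) (E₀ := ((E0 : ℚ) : ℝ)) (ET := ((ET : ℕ) : ℝ)) ((τ : ℚ) : ℝ)
    hQ1 KM (fun i => ((σM i : ℚ) : ℝ)) hKM (by simp only [hσM0]) (by simp only [hσMK])
    (fun i => c.eM (mrowsP i)) (fun i j => (rowAt (mrowsP i) j).steps.length)
    (fun i hi => mMeta_hyps (mrowsP i) E0 τ ET J hJR (hmetaM i hi))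
    (fun i hi j hj m hm => by
      have hjJ : j < J := by
        by_contra hcon
        push Not at hcon
        have : (J : ℝ) ≤ j := by exact_mod_cast hcon
        linarith
      exact hboxes i hi j hjJ m hm)
  -- the tail terms on the whole twist domain: (M) below `E_T`, (T) from `E_T` on
  have htail := tail_nonneg_of_pointRules_twist c.wR c.zR c.zbR hz hzb hord ⟨c.apex, apex_lt hc⟩ hapex
    (c.qR qd) (c.qR qr) hqd hqr hdomd hdomr hQ1 hM hB
  exact boxExcluded_of_pointCells hz hzb hord ⟨c.apex, apex_lt hc⟩ hapex (c.qR qd) (c.qR qr) hqd hqr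
    hdomd hdomr t K tε Kε (fun p hp => ⟨hp.1, Or.inl hp.2⟩) L (by exact_mod_cast hL)
    (by exact_mod_cast hτ1) (by exact_mod_cast hτ0) hI htε ht0 htℓ
    (fun k hk p hp Δ hΔ => hcellε k hk _ hQ1 htail p hp Δ hΔ)
    (fun ℓ hℓ k hk p hp Δ hΔ => hcell ℓ hℓ k hk _ hQ1 htail p hp Δ hΔ) hM hB

end PCert

end PointKernel

end Literature.MathematicalPhysics.QuantumFieldTheory.ConformalBootstrap3D
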